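import Mathlib.Analysis.SpecialFunctions.Pow.Continuity
import Mathlib.Analysis.Normed.Operator.Bilinear
import Mathlib.MeasureTheory.Integral.IntervalIntegral.Basic
import Mathlib.Topology.ContinuousMap.Compact
import Literature.Analysis.ODE.WeaklySingularGronwallZero
import HarnessLib

/-!
# Operators of the mild formulation of a semilinear parabolic equation on `C([0, τ]; E)`

Analysis/UnboundedOperators support file (everything proved; no definitions, no named facts).  The
bounded (multi)linear operators through which the mild (variation-of-constants) form

  `y(t) = T(t) y₀ + ∫₀ᵗ T(t − s) f ds − ∫₀ᵗ K(t − s) N(y(s), y(s)) ds`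

of an abstract semilinear parabolic equation (D. Henry, *Geometric Theory of Semilinear Parabolic
Equations*, LNM 840 (1981), §3.3, (3.2.2); A. Pazy, *Semigroups of Linear Operators and Applications to
PDE* (1983), §6.3) becomes a quadratic fixed-point problem `y = A y₀ + F₀ − Φ (B y y)` on the Banach space
`C([0, τ]; E)` (`C(Icc 0 τ, E)` with the uniform norm):

* `exists_orbitCLM` — the orbit map `A : E →L C([0, τ]; E)`, `(A y)(t) = T(t) y`, of a strongly continuous
  family of contractions, `‖A y‖ ≤ ‖y‖`;
* `exists_forcingCurve` — the forcing curve `F₀ ∈ C([0, τ]; E)`, `F₀(t) = ∫₀ᵗ T(t − s) f ds`, with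
  `‖F₀(t)‖ ≤ t ‖f‖`;
* `exists_nemytskiiBilinearCLM` — the pointwise (Nemytskii) extension `B` of a bounded bilinear map `N` to
  continuous curves on a compact space, `(B y z)(k) = N (y k) (z k)`, `‖B y z‖ ≤ ‖N‖ ‖y‖ ‖z‖`;
* `norm_integral_weaklySingular_le` — the pointwise weakly singular bound
  `‖∫₀ᵗ K(t − s) g(s) ds‖ ≤ C ∫₀ᵗ (t − s)^{−α} ‖g(s)‖ ds` for `‖K(t)‖ ≤ C t^{−α}`, `α < 1`
  (the input of the singular Grönwall uniqueness argument, Henry 1981, Thm. 3.3.3);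
* `exists_pos_le_mul_rpow_le` — choice of a short time: `M τ^β ≤ ε` for some `0 < τ ≤ b` (`β > 0`).

The Duhamel operator `Φ` itself (`(Φ G)(t) = ∫₀ᵗ K(t − s) G(s) ds` as a bounded operator on `C([0, τ]; E)`)
is the sibling `WeaklySingularDuhamel.lean`; the smooth solution map is assembled in
`SemilinearMildFlow.lean`.

## References

* D. Henry, *Geometric Theory of Semilinear Parabolic Equations*, LNM 840, Springer (1981), §3.3,
  Lemma 3.3.2, Thm. 3.3.3. [Henry1981]
* A. Pazy, *Semigroups of Linear Operators and Applications to Partial Differential Equations*, Springer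
  (1983), §6.3, Thm. 6.3.1. [Pazy1983]
-/

noncomputable section

open Set Filter MeasureTheory intervalIntegral Metric
open _root_.Topology

namespace Literature.Analysis.UnboundedOperators

section Orbit

variable {E : Type*} [NormedAddCommGroup E] [NormedSpace ℝ E]

/-- **The orbit map of a strongly continuous family of contractions** as a bounded linear operator
`A : E →L C([0, τ]; E)`, `(A y)(t) = T(t) y`, with `‖A y‖ ≤ ‖y‖` (Pazy 1983, §6.3: the term `T(t − t₀)u₀`
of the mild formulation as an element of `C([t₀, t₁] : X)`). [folklore] -/
theorem exists_orbitCLM (T : ℝ → E →L[ℝ] E) (hTnorm : ∀ t, 0 ≤ t → ‖T t‖ ≤ 1)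
    (hTc : ∀ y : E, Continuous fun t : ℝ => T t y) (τ : ℝ) :
    ∃ A : E →L[ℝ] C(Icc (0 : ℝ) τ, E),
      (∀ (y : E) (t : Icc (0 : ℝ) τ), A y t = T t y) ∧ ∀ y : E, ‖A y‖ ≤ ‖y‖ := by
  have hb : ∀ y : E,
      ‖(⟨fun t : Icc (0 : ℝ) τ => T t y, (hTc y).comp continuous_subtype_val⟩ : C(Icc (0 : ℝ) τ, E))‖ ≤
        ‖y‖ := fun y =>
    (ContinuousMap.norm_le _ (norm_nonneg y)).2 fun t =>
      ((T t).le_of_opNorm_le (hTnorm t t.2.1) y).trans (by rw [one_mul])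
  refine ⟨LinearMap.mkContinuous
      { toFun := fun y => ⟨fun t : Icc (0 : ℝ) τ => T t y, (hTc y).comp continuous_subtype_val⟩
        map_add' := fun y z => by ext t; simp
        map_smul' := fun c y => by ext t; simp } 1 fun y => ?_, fun y t => rfl, fun y => hb y⟩
  rw [one_mul]
  exact hb y

/-- **The forcing curve** `F₀(t) = ∫₀ᵗ T(t − s) f ds = ∫₀ᵗ T(u) f du` of a constant forcing `f` under a
strongly continuous family of contractions, as an element of `C([0, τ]; E)` with `‖F₀(t)‖ ≤ t ‖f‖`
(Pazy 1983, §6.3, the term `∫ T(t − s) f(s) ds` of (3.2)). [folklore] -/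
theorem exists_forcingCurve (T : ℝ → E →L[ℝ] E) (hTnorm : ∀ t, 0 ≤ t → ‖T t‖ ≤ 1)
    (hTc : ∀ y : E, Continuous fun t : ℝ => T t y) (f : E) (τ : ℝ) :
    ∃ F₀ : C(Icc (0 : ℝ) τ, E),
      (∀ t : Icc (0 : ℝ) τ, F₀ t = ∫ s in (0 : ℝ)..(t : ℝ), T ((t : ℝ) - s) f) ∧
      ∀ t : Icc (0 : ℝ) τ, ‖F₀ t‖ ≤ (t : ℝ) * ‖f‖ := by
  have hint : ∀ a b : ℝ, IntervalIntegrable (fun u => T u f) volume a b := fun a b =>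
    (hTc f).intervalIntegrable a b
  have hsub : ∀ t : ℝ, ∫ s in (0 : ℝ)..t, T (t - s) f = ∫ u in (0 : ℝ)..t, T u f := fun t => by
    rw [intervalIntegral.integral_comp_sub_left (fun u => T u f) t, sub_self, sub_zero]
  refine ⟨⟨fun t : Icc (0 : ℝ) τ => ∫ u in (0 : ℝ)..(t : ℝ), T u f,
    (intervalIntegral.continuous_primitive hint 0).comp continuous_subtype_val⟩,
    fun t => (hsub t).symm, fun t => ?_⟩
  show ‖∫ u in (0 : ℝ)..(t : ℝ), T u f‖ ≤ (t : ℝ) * ‖f‖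
  calc ‖∫ u in (0 : ℝ)..(t : ℝ), T u f‖ ≤ ‖f‖ * |(t : ℝ) - 0| :=
        intervalIntegral.norm_integral_le_of_norm_le_const fun u hu => by
          rw [uIoc_of_le t.2.1] at hu
          calc ‖T u f‖ ≤ ‖T u‖ * ‖f‖ := (T u).le_opNorm f
            _ ≤ 1 * ‖f‖ := by gcongr; exact hTnorm u hu.1.le
            _ = ‖f‖ := one_mul _
    _ = (t : ℝ) * ‖f‖ := by rw [sub_zero, abs_of_nonneg t.2.1, mul_comm]

end Orbit

section Nemytskii

variable {K : Type*} [TopologicalSpace K] [CompactSpace K]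
  {E F G : Type*} [NormedAddCommGroup E] [NormedSpace ℝ E] [NormedAddCommGroup F] [NormedSpace ℝ F]
  [NormedAddCommGroup G] [NormedSpace ℝ G]

/-- **The Nemytskii extension of a bounded bilinear map to continuous curves.**  For a bounded bilinear
`N : E × F → G` and a compact space `K` there is a bounded bilinear
`B : C(K, E) × C(K, F) → C(K, G)` with `(B y z)(k) = N (y k) (z k)` and `‖B y z‖ ≤ ‖N‖ ‖y‖ ‖z‖`
(uniform norms); with `y = z` this is the substitution operator `y ↦ N(y(·), y(·))` of the mild
formulation (Henry 1981, §3.3; Pazy 1983, §6.3, the map `F` of the proof of Thm. 6.3.1). [folklore] -/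
theorem exists_nemytskiiBilinearCLM (N : E →L[ℝ] F →L[ℝ] G) :
    ∃ B : C(K, E) →L[ℝ] C(K, F) →L[ℝ] C(K, G),
      (∀ (y : C(K, E)) (z : C(K, F)) (k : K), B y z k = N (y k) (z k)) ∧
      ∀ (y : C(K, E)) (z : C(K, F)), ‖B y z‖ ≤ ‖N‖ * ‖y‖ * ‖z‖ := by
  have hcont : ∀ (y : C(K, E)) (z : C(K, F)), Continuous fun k => N (y k) (z k) := fun y z =>
    (N.continuous.comp y.continuous).clm_apply z.continuous
  have hb : ∀ (y : C(K, E)) (z : C(K, F)),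
      ‖(⟨fun k => N (y k) (z k), hcont y z⟩ : C(K, G))‖ ≤ ‖N‖ * ‖y‖ * ‖z‖ := fun y z =>
    (ContinuousMap.norm_le _ (by positivity)).2 fun k =>
      calc ‖N (y k) (z k)‖ ≤ ‖N‖ * ‖y k‖ * ‖z k‖ := N.le_opNorm₂ _ _
        _ ≤ ‖N‖ * ‖y‖ * ‖z‖ := by
            gcongr
            · exact ContinuousMap.norm_coe_le_norm y k
            · exact ContinuousMap.norm_coe_le_norm z k
  refine ⟨LinearMap.mkContinuous₂
      (LinearMap.mk₂ ℝ (fun (y : C(K, E)) (z : C(K, F)) => (⟨fun k => N (y k) (z k), hcont y z⟩ : C(K, G)))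
        (fun y y' z => by ext; simp) (fun c y z => by ext; simp) (fun y z z' => by ext; simp)
        (fun c y z => by ext; simp))
      ‖N‖ fun y z => hb y z, fun y z k => rfl, fun y z => hb y z⟩

end Nemytskii

section Kernel

variable {E F : Type*} [NormedAddCommGroup E] [NormedSpace ℝ E] [NormedAddCommGroup F] [NormedSpace ℝ F]

/-- **The pointwise weakly singular bound** `‖∫₀ᵗ K(t − s) g(s) ds‖ ≤ C ∫₀ᵗ (t − s)^{−α} ‖g(s)‖ ds` for an
operator family with `‖K(t)‖ ≤ C t^{−α}` (`t > 0`, `α < 1`), a continuous `g` and `t ≥ 0`: the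
integrand is dominated off the endpoint `s = t` by the integrable majorant `C (t − s)^{−α} ‖g(s)‖`
(Henry 1981, proof of Thm. 3.3.3; Pazy 1983, proof of Thm. 6.3.1, (3.8)). [folklore] -/
theorem norm_integral_weaklySingular_le {α C : ℝ} {K : ℝ → E →L[ℝ] F} (hα : α < 1)
    (hK : ∀ t, 0 < t → ‖K t‖ ≤ C * t ^ (-α)) {g : ℝ → E} (hg : Continuous g) {t : ℝ} (ht : 0 ≤ t) :
    ‖∫ s in (0 : ℝ)..t, K (t - s) (g s)‖ ≤ C * ∫ s in (0 : ℝ)..t, (t - s) ^ (-α) * ‖g s‖ := by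
  have hbound : IntervalIntegrable (fun s => C * ((t - s) ^ (-α) * ‖g s‖)) volume 0 t :=
    (Literature.Analysis.ODE.intervalIntegrable_sub_rpow_neg_mul hα t hg.norm.continuousOn).const_mul C
  calc ‖∫ s in (0 : ℝ)..t, K (t - s) (g s)‖ ≤ ∫ s in (0 : ℝ)..t, C * ((t - s) ^ (-α) * ‖g s‖) := by
        refine intervalIntegral.norm_integral_le_of_norm_le ht ?_ hbound
        filter_upwards [compl_mem_ae_iff.mpr (Real.volume_singleton (a := t))] with s hst hs
        have hst' : s < t := lt_of_le_of_ne hs.2 hst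
        calc ‖K (t - s) (g s)‖ ≤ C * (t - s) ^ (-α) * ‖g s‖ :=
              (K (t - s)).le_of_opNorm_le (hK _ (sub_pos.2 hst')) _
          _ = C * ((t - s) ^ (-α) * ‖g s‖) := mul_assoc _ _ _
    _ = C * ∫ s in (0 : ℝ)..t, (t - s) ^ (-α) * ‖g s‖ := intervalIntegral.integral_const_mul _ _

end Kernel

/-- **Choice of a short time interval**: for `β > 0`, `ε > 0` and `b > 0` there is `τ` with `0 < τ ≤ b`
and `M τ^β ≤ ε` (continuity of `τ ↦ τ^β` at `0`).  In the mild-solution fixed-point argument this makes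
the Lipschitz constant `C ‖N‖ R τ^{1−α}/(1−α)` of the Duhamel term small (Pazy 1983, proof of Thm. 6.3.1,
(3.5)). [folklore] -/
theorem exists_pos_le_mul_rpow_le {β M ε b : ℝ} (hβ : 0 < β) (hε : 0 < ε) (hb : 0 < b) :
    ∃ τ : ℝ, 0 < τ ∧ τ ≤ b ∧ M * τ ^ β ≤ ε := by
  have hc : ContinuousAt (fun τ : ℝ => M * τ ^ β) 0 :=
    continuousAt_const.mul (Real.continuousAt_rpow_const 0 β (Or.inr hβ.le))
  have hev : ∀ᶠ τ in 𝓝 (0 : ℝ), M * τ ^ β < ε :=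
    hc.eventually_lt continuousAt_const (by simp only [Real.zero_rpow hβ.ne', mul_zero]; exact hε)
  obtain ⟨δ, hδ, hδP⟩ := Metric.eventually_nhds_iff.1 hev
  have hpos : 0 < min (δ / 2) b := lt_min (half_pos hδ) hb
  refine ⟨min (δ / 2) b, hpos, min_le_right _ _, (hδP ?_).le⟩
  rw [dist_zero_right, Real.norm_eq_abs, abs_of_pos hpos]
  exact (min_le_left _ _).trans_lt (half_lt_self hδ)

end Literature.Analysis.UnboundedOperators

end
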